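import Mathlib.Data.List.Cycle
import Mathlib.Data.Fintype.Basic
import Mathlib.Algebra.BigOperators.Group.List.Basic
import Mathlib.Tactic.FinCases
import Mathlib.Tactic.Ring
import Mathlib.Tactic.Linarith
import Mathlib.Tactic.NormNum
import Mathlib.Tactic.Abel
import Mathlib.Tactic.LinearCombination
import HarnessLib

/-!
# Rectilinear lattice loops: turning sums, rotations, and local windows

Topic `Literature/Topology/PlaneTopology`; first of four files proving the **rectilinear
Umlaufsatz** — a simple closed walk on `ℤ²` with unit axis-parallel steps turns by `±2π` in total,
i.e. the signed number of quarter turns is `±4` (H. Hopf, *Über die Drehung der Tangenten und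
Sehnen ebener Kurven*, Compositio Math. 2 (1935), Satz I, for polygons; the orthogonal-polygon form
"an orthogonal polygon has four more convex than reflex vertices" is folklore) — which is the
planar-topology input `medialCycle_turning` (T2 of
`Probability/LatticeModels/WeightTable.lean`) of the s-holomorphicity of the FK-Ising observable (`Probability/LatticeModels/MedialCycleTurning.lean` transports it to
cycles of the turning rule).
The proof (`RectilinearLoopMoves.lean`, `RectilinearLoopCorners.lean`,
`RectilinearUmlaufsatz.lean`) is purely combinatorial: local moves at the top-left vertex and
along a diagonal chain of corners reduce every loop to the unit square. Mathlib has winding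
numbers of continuous loops but no turning number of polygons (grep `Umlaufsatz`, `turning
number`, `rotation index`: nothing), hence the self-contained combinatorial treatment.

This file: the vocabulary, all definitions of the development, and the cyclic bookkeeping.

* `RectLoop.dir k` (the four unit vectors, counter-clockwise from east), `RectLoop.cross`,
  `RectLoop.Adj` (lattice adjacency), `RectLoop.turnSum` (signed quarter turns of an open
  polyline), `RectLoop.cycTurn l = turnSum (l ++ l.take 2)` (of the closed polyline),
  `RectLoop.IsLoop` (at least three distinct vertices, cyclically adjacent), `RectLoop.CornerAt`
  (a vertex whose neighbours are `v + e₀`, `v - e₁`), `RectLoop.height B`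
  (the potential `∑ (y - B)` used for termination), `RectLoop.code` (the coding of medial
  corners `(v, k)` by lattice points `2v + w_k`, used by the transport).
* Invariance of `cycTurn` and `IsLoop` under rotation (`cycTurn_rotate`, `IsLoop.rotate`),
  windows: every vertex can be rotated to position `2` or `3` of a list with five explicit
  entries (`exists_window_two`, `exists_window_three`).

Everything is elementary list algebra. [folklore]
-/

namespace Literature.Topology.PlaneTopology

namespace RectLoop

open List

/-! ### Directions, cross products, adjacency -/

/-- The four unit vectors of `ℤ²`, counter-clockwise from east: `e₀, e₁, -e₀, -e₁`. [folklore] -/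
def dir : Fin 4 → ℤ × ℤ
  | 0 => (1, 0)
  | 1 => (0, 1)
  | 2 => (-1, 0)
  | 3 => (0, -1)

/-- The planar cross product `a × b = a₁ b₂ - a₂ b₁`; for unit vectors it is the signed quarter
turn from `a` to `b` (`+1` left, `-1` right, `0` straight or back). [folklore] -/
def cross (a b : ℤ × ℤ) : ℤ := a.1 * b.2 - a.2 * b.1

/-- Lattice adjacency: `q = p + dir i` for some direction `i`. [folklore] -/
def Adj (p q : ℤ × ℤ) : Prop := ∃ i : Fin 4, q = p + dir i

/-- Adjacency is decidable (a finite search over the four directions); a local convenience, not a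
Mathlib instance. [folklore] -/
instance Adj.decidable (p q : ℤ × ℤ) : Decidable (Adj p q) := by unfold Adj; infer_instance

/-- Opposite directions: `-dir i = dir (i + 2)`. [folklore] -/
theorem neg_dir (i : Fin 4) : -dir i = dir (i + 2) := by
  fin_cases i <;> rfl

/-- Adjacency is symmetric. [folklore] -/
theorem Adj.symm {p q : ℤ × ℤ} (h : Adj p q) : Adj q p := by
  obtain ⟨i, rfl⟩ := h
  exact ⟨i + 2, by rw [← neg_dir]; simp⟩

/-- Adjacency is irreflexive. [folklore] -/
theorem Adj.ne {p q : ℤ × ℤ} (h : Adj p q) : p ≠ q := by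
  obtain ⟨i, rfl⟩ := h
  intro h
  fin_cases i <;> simp [dir, Prod.ext_iff] at h

/-! ### Turning sums -/

/-- The signed number of quarter turns of the open polyline through the points of the list: the
sum over interior points of `cross (incoming step) (outgoing step)`. [folklore] -/
def turnSum : List (ℤ × ℤ) → ℤ
  | a :: b :: c :: l => cross (b - a) (c - b) + turnSum (b :: c :: l)
  | _ => 0

/-- Unfolding `turnSum` at a triple. [folklore] -/
@[simp] theorem turnSum_cons_cons_cons (a b c : ℤ × ℤ) (l : List (ℤ × ℤ)) :
    turnSum (a :: b :: c :: l) = cross (b - a) (c - b) + turnSum (b :: c :: l) := rfl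

/-- Lists with fewer than three points do not turn. [folklore] -/
@[simp] theorem turnSum_pair (a b : ℤ × ℤ) : turnSum [a, b] = 0 := rfl

/-- Appending one point adds the turn at the old endpoint. [folklore] -/
theorem turnSum_append_three (l : List (ℤ × ℤ)) (a b c : ℤ × ℤ) :
    turnSum (l ++ [a, b, c]) = turnSum (l ++ [a, b]) + cross (b - a) (c - b) := by
  induction l with
  | nil => simp [turnSum]
  | cons x l ih =>
    match l, ih with
    | [], _ => simp [turnSum]
    | [y], _ => simp [turnSum]; ring
    | y :: z :: l, ih =>
      simp only [cons_append, turnSum_cons_cons_cons] at ih ⊢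
      rw [ih]; ring

/-- The signed number of quarter turns of the *closed* polyline through the points of `l`
(returning from the last point to the first): the turns at all its vertices. [folklore] -/
def cycTurn (l : List (ℤ × ℤ)) : ℤ := turnSum (l ++ l.take 2)

/-- Rotating the closed polyline by one does not change its turning. [folklore] -/
theorem cycTurn_rotate_one {l : List (ℤ × ℤ)} (hl : 3 ≤ l.length) : cycTurn (l.rotate 1) = cycTurn l := by
  match l, hl with
  | x :: y :: z :: l, _ =>
    rw [rotate_cons_succ, rotate_zero]
    have e1 : (y :: z :: l ++ [x]) ++ (y :: z :: l ++ [x]).take 2 = (y :: z :: l) ++ [x, y, z] := by simp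
    have e2 : (x :: y :: z :: l) ++ (x :: y :: z :: l).take 2 = x :: ((y :: z :: l) ++ [x, y]) := by simp
    rw [cycTurn, cycTurn, e1, e2, turnSum_append_three]
    simp only [cons_append, turnSum_cons_cons_cons]
    ring

/-- Rotations do not change the turning of a closed polyline. [folklore] -/
theorem cycTurn_rotate {l : List (ℤ × ℤ)} (hl : 3 ≤ l.length) (n : ℕ) : cycTurn (l.rotate n) = cycTurn l := by
  induction n with
  | zero => rw [rotate_zero]
  | succ n ih => rw [← rotate_rotate, cycTurn_rotate_one (by rwa [length_rotate]), ih]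

/-- Rotated lists have the same turning. [folklore] -/
theorem cycTurn_eq_of_isRotated {l l' : List (ℤ × ℤ)} (h : l ~r l') (hl : 3 ≤ l.length) :
    cycTurn l' = cycTurn l := by
  obtain ⟨n, rfl⟩ := h
  exact cycTurn_rotate hl n

/-! ### Loops -/

/-- A **rectilinear lattice loop**: at least three pairwise distinct points of `ℤ²`, consecutive
ones adjacent, the last adjacent to the first (a simple closed walk with unit axis-parallel
steps). [folklore] -/
structure IsLoop (l : List (ℤ × ℤ)) : Prop where
  /-- At least three vertices. -/
  three_le : 3 ≤ l.length
  /-- The vertices are distinct. -/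
  nodup : l.Nodup
  /-- Consecutive vertices, and the last and the first, are adjacent. -/
  chain : List.IsChain Adj (l ++ l.take 1)

/-- The closing condition, unfolded for a list with explicit head. [folklore] -/
theorem isChain_close_iff (x : ℤ × ℤ) (l : List (ℤ × ℤ)) :
    List.IsChain Adj (x :: l ++ (x :: l).take 1) ↔
      List.IsChain Adj (x :: l) ∧ ∀ z ∈ (x :: l).getLast?, Adj z x := by
  simp only [take_succ_cons, take_zero]
  rw [show x :: l ++ [x] = (x :: l) ++ [x] from rfl, isChain_append]
  simp

/-- Rotating a loop by one gives a loop. [folklore] -/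
theorem IsLoop.rotate_one {l : List (ℤ × ℤ)} (h : IsLoop l) : IsLoop (l.rotate 1) := by
  obtain ⟨h3, hnd, hch⟩ := h
  match l, h3, hnd, hch with
  | x :: y :: z :: l, _, hnd, hch =>
    refine ⟨by simp, nodup_rotate.2 hnd, ?_⟩
    rw [rotate_cons_succ, rotate_zero]
    rw [isChain_close_iff] at hch
    obtain ⟨h1, h2⟩ := hch
    have hxy : Adj x y := (isChain_cons_cons.1 h1).1
    have hrest : IsChain Adj (y :: z :: l) := (isChain_cons_cons.1 h1).2
    have hlast : Adj ((y :: z :: l).getLast (by simp)) x := by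
      apply h2
      rw [getLast?_eq_getLast_of_ne_nil (by simp : x :: y :: z :: l ≠ []), getLast_cons (by simp)]
      rfl
    have e1 : (y :: z :: l ++ [x]) ++ (y :: z :: l ++ [x]).take 1 = (y :: z :: l) ++ [x, y] := by simp
    rw [e1, isChain_append]
    refine ⟨hrest, ?_, ?_⟩
    · exact isChain_cons_cons.2 ⟨hxy, isChain_singleton _⟩
    · intro a ha b hb
      rw [getLast?_eq_getLast_of_ne_nil (by simp)] at ha
      simp only [Option.mem_def, Option.some.injEq, head?_cons] at ha hb
      subst ha; subst hb
      exact hlast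

/-- Rotations of loops are loops. [folklore] -/
theorem IsLoop.rotate {l : List (ℤ × ℤ)} (h : IsLoop l) (n : ℕ) : IsLoop (l.rotate n) := by
  induction n with
  | zero => rwa [rotate_zero]
  | succ n ih => rw [← rotate_rotate]; exact ih.rotate_one

/-- In a loop written with explicit first vertices, consecutive explicit vertices are adjacent:
the first two. [folklore] -/
theorem IsLoop.adj₀₁ {x₀ x₁ : ℤ × ℤ} {l : List (ℤ × ℤ)} (h : IsLoop (x₀ :: x₁ :: l)) : Adj x₀ x₁ := by
  have := h.chain
  simp only [cons_append, take_succ_cons, take_zero] at this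
  exact (isChain_cons_cons.1 this).1

/-- Dropping the first vertex of the explicit part keeps the chain property needed for the
adjacency lemmas (not a loop any more in general, but the open chain remains). [folklore] -/
theorem IsLoop.isChain {l : List (ℤ × ℤ)} (h : IsLoop l) : IsChain Adj l := by
  have := h.chain
  rw [isChain_append] at this
  exact this.1

/-! ### Windows: rotating a vertex to position `2` or `3` -/

/-- A list of length at least five has five explicit entries. [folklore] -/
theorem exists_five {α : Type*} {l : List α} (h : 5 ≤ l.length) :
    ∃ a b c d e r, l = a :: b :: c :: d :: e :: r := by
  match l, h with
  | a :: b :: c :: d :: e :: r, _ => exact ⟨a, b, c, d, e, r, rfl⟩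

/-- Every vertex of a loop with at least five vertices sits at position `2` of a rotation with
five explicit entries. [folklore] -/
theorem exists_window_two {l : List (ℤ × ℤ)} (h5 : 5 ≤ l.length) {v : ℤ × ℤ} (hv : v ∈ l) :
    ∃ x₀ x₁ x₃ x₄ r, l ~r (x₀ :: x₁ :: v :: x₃ :: x₄ :: r) := by
  obtain ⟨m, hm, rfl⟩ := getElem_of_mem hv
  have hlen : (l.rotate (m + (l.length - 2))).length = l.length := length_rotate _ _
  obtain ⟨a, b, c, d, e, r, hr⟩ := exists_five (l := l.rotate (m + (l.length - 2))) (by omega)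
  have key : (l.rotate (m + (l.length - 2)))[2]'(by omega) = l[m] := by
    rw [getElem_rotate]; congr 1
    rw [show 2 + (m + (l.length - 2)) = m + l.length by omega, Nat.add_mod_right, Nat.mod_eq_of_lt hm]
  have h2 : (l.rotate (m + (l.length - 2)))[2]'(by omega) = c := by rw [getElem_of_eq hr]; rfl
  refine ⟨a, b, d, e, r, m + (l.length - 2), ?_⟩
  rw [hr, ← key, h2]

/-- Every vertex of a loop with at least five vertices sits at position `3` of a rotation with
five explicit entries. [folklore] -/
theorem exists_window_three {l : List (ℤ × ℤ)} (h5 : 5 ≤ l.length) {v : ℤ × ℤ} (hv : v ∈ l) :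
    ∃ z x₀ x₁ x₃ r, l ~r (z :: x₀ :: x₁ :: v :: x₃ :: r) := by
  obtain ⟨m, hm, rfl⟩ := getElem_of_mem hv
  have hlen : (l.rotate (m + (l.length - 3))).length = l.length := length_rotate _ _
  obtain ⟨a, b, c, d, e, r, hr⟩ := exists_five (l := l.rotate (m + (l.length - 3))) (by omega)
  have key : (l.rotate (m + (l.length - 3)))[3]'(by omega) = l[m] := by
    rw [getElem_rotate]; congr 1
    rw [show 3 + (m + (l.length - 3)) = m + l.length by omega, Nat.add_mod_right, Nat.mod_eq_of_lt hm]
  have h3 : (l.rotate (m + (l.length - 3)))[3]'(by omega) = d := by rw [getElem_of_eq hr]; rfl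
  refine ⟨a, b, c, e, r, m + (l.length - 3), ?_⟩
  rw [hr, ← key, h3]

/-- `v` is a **corner of type `{e₀, -e₁}`** of the cyclic list `l`: some rotation of `l` shows `v`
with five explicit vertices around it, its two neighbours being `v + e₀` and `v - e₁` (in either
order). The top-left vertex of a loop is such a corner, and the reduction of
`RectilinearUmlaufsatz.lean` walks along a diagonal of such corners. [folklore] -/
def CornerAt (l : List (ℤ × ℤ)) (v : ℤ × ℤ) : Prop :=
  ∃ x₀ x₁ x₃ x₄ R, l ~r (x₀ :: x₁ :: v :: x₃ :: x₄ :: R) ∧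
    ((x₁ = v + dir 0 ∧ x₃ = v + dir 3) ∨ (x₁ = v + dir 3 ∧ x₃ = v + dir 0))

/-- A corner is a vertex. [folklore] -/
theorem CornerAt.mem {l : List (ℤ × ℤ)} {v : ℤ × ℤ} (h : CornerAt l v) : v ∈ l := by
  obtain ⟨x₀, x₁, x₃, x₄, R, hrot, -⟩ := h
  rw [hrot.mem_iff]; simp

/-- Corners are invariant under rotation of the list. [folklore] -/
theorem CornerAt.of_isRotated {l l' : List (ℤ × ℤ)} {v : ℤ × ℤ} (h : CornerAt l v) (hr : l ~r l') :
    CornerAt l' v := by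
  obtain ⟨x₀, x₁, x₃, x₄, R, hrot, h13⟩ := h
  exact ⟨x₀, x₁, x₃, x₄, R, hr.symm.trans hrot, h13⟩

/-! ### The potential and the corner code -/

/-- The potential `∑_{p ∈ l} (p₂ - B)⁺` (total height above the level `B`), which decreases by
one when a vertex is lowered by one and all vertices stay at height `≥ B`. [folklore] -/
def height (B : ℤ) (l : List (ℤ × ℤ)) : ℕ := (l.map fun p => (p.2 - B).toNat).sum

/-- `height` of a cons. [folklore] -/
@[simp] theorem height_cons (B : ℤ) (p : ℤ × ℤ) (l : List (ℤ × ℤ)) :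
    height B (p :: l) = (p.2 - B).toNat + height B l := by
  simp [height]

/-- `height` is invariant under permutations, in particular rotations. [folklore] -/
theorem height_eq_of_perm {B : ℤ} {l l' : List (ℤ × ℤ)} (h : l ~ l') : height B l = height B l' :=
  (h.map _).sum_eq

/-- The offsets `w_k` of the corner code: `0, -e₀, -e₀ - e₁, -e₁`. [folklore] -/
def codeOff : Fin 4 → ℤ × ℤ
  | 0 => (0, 0)
  | 1 => (-1, 0)
  | 2 => (-1, -1)
  | 3 => (0, -1)

/-- The **corner code**: the medial corner coded by the pair `p = (v, k)` (vertex `v ∈ ℤ²`, as a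
function `Fin 2 → ℤ`, and the index `k` of the quadrant between the directions `k` and `k + 1`)
is sent to the lattice point `2v + w_k`. Consecutive corners of the turning rule have adjacent
codes (`Probability/LatticeModels/MedialCycleTurning.lean`), so cycles of the turning rule become
rectilinear lattice loops.
This is the affine image of the quarter-offset points `v + (u_k + u_{k+1})/4` at which Smirnov
rounds the corners of the medial loops (Ann. Math. 172 (2010), §4, Fig. 5). [folklore] -/
def code (p : (Fin 2 → ℤ) × Fin 4) : ℤ × ℤ := (2 : ℤ) • ((p.1 0, p.1 1) : ℤ × ℤ) + codeOff p.2

end RectLoop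

end Literature.Topology.PlaneTopology
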